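import Summits.BirchSwinnertonDyer.BirchSwinnertonDyer.Theorems.PrintCf2RubinValueTwoTowerLift
import Summits.BirchSwinnertonDyer.BirchSwinnertonDyer.Theorems.EisensteinPrimesTwoVariableSelmerControl
import HarnessLib

/-!
# M-LINE-PIN, (C2a′): the tower lift for the FIRST slot — every `γ₂`-invariant class of `H¹(K̃_∞, M)` is a restriction from `H¹(K_∞^{(1)}, M)`

Cell `bsd-print-cf2`, width seat `bsd-line-cf2c-w8` g3 (prover-bsd-line-cf2c-w8-g3-0), planner g19's named piece M-LINE-PIN, memo
`Cruxes/TwoVariableMainConjAtSplitTwo/M-LINE-PIN-cf2c-w8g3.md` §2 (sequel of (C1) p695906 and (C2a) p696177). `--supports stmt-BirchSwinnertonDyer-24086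
--as helper`, Theses-free. HONEST FRAMING: Greenberg's Lemma 3.2 in the tower direction for the FIRST coordinate, obtained from cf2c-w8 g0's
second-coordinate theorem (p683924 `ZpExtension.mem_range_resOfLe_pairKer_right_of_conjH1_eq`) by the symmetry of the pair
(`IsTopGeneratorPair.symm`, `pairKer_comm`); generic (any field `K` of characteristic zero in the source's generality — here a number field —,
any prime `p`, any discrete `p`-primary `M` with continuous orbits). With (C2a) this says: the cokernel of M-LINE-PIN's slot-1 control onto the
`γ₂`-invariants consists of LIFTABLE classes, so it is measured exactly by the failure of the datum's `𝔮 = v̄` condition on lifts. No summit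
statement is proved by this seat; BSD is not proved by any of this. THEOREMS ONLY (no definition, no named fact, no `sorry`).
presearch: Greenberg LNM 1716 §3 Lemma 3.2 (tree theorem, p683924); transport along `pairKer κ₁ κ₂ = pairKer κ₂ κ₁`. beyond-print theorem: no.

References: [GreenbergLNM1716] §3 Lemma 3.2; [SerreGaloisCohomology1997] I §2.6, §3.4; [Rubin1991] §4 p. 36.
-/

noncomputable section

open scoped Classical

-- the summit namespace `Summit.BirchSwinnertonDyer.BirchSwinnertonDyer` repeats the problem name by design (D-0017)
set_option linter.dupNamespace false
set_option autoImplicit false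

open Literature.NumberTheory.EllipticCurves Literature.NumberTheory.GaloisRepresentations

universe u

namespace Literature.NumberTheory.EllipticCurves.ZpExtension

variable {K : Type u} [Field K] [NumberField K] {p : ℕ} [Fact p.Prime] {κ₁ κ₂ : ZpExtension K p}
  {γ₁ γ₂ : Field.absoluteGaloisGroup K}
  {M : Type u} [AddCommGroup M] [DistribMulAction (Field.absoluteGaloisGroup K) M] [TopologicalSpace M] [DiscreteTopology M]

omit [NumberField K] [Fact p.Prime] in
/-- Restriction along a chain `H₁ ≤ H₂ ≤ H₃` (the tree's `resOfLe_comp_holds`, element form). [folklore] -/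
private theorem resOfLe_resOfLe {H₁ H₂ H₃ : Subgroup (Field.absoluteGaloisGroup K)} (h₁₂ : H₁ ≤ H₂) (h₂₃ : H₂ ≤ H₃)
    (x : subgroupH1 H₃ M) : resOfLe M h₁₂ (resOfLe M h₂₃ x) = resOfLe M (h₁₂.trans h₂₃) x := by
  rw [← AddMonoidHom.comp_apply, resOfLe_comp_holds]

omit [NumberField K] [Fact p.Prime] in
/-- Restriction along `H ≤ H` (any proof) is the identity (the tree's `resOfLe_refl_holds`). [folklore] -/
private theorem resOfLe_self {H : Subgroup (Field.absoluteGaloisGroup K)} (h : H ≤ H) (x : subgroupH1 H M) : resOfLe M h x = x := by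
  rw [show resOfLe M h = resOfLe M (le_refl H) from rfl, resOfLe_refl_holds H, AddMonoidHom.id_apply]

/-- **Greenberg's Lemma 3.2 in the tower direction, FIRST coordinate**: for a generator pair `(κ₁, κ₂; γ₁, γ₂)` and a discrete `p`-primary
`M` with continuous orbits, the restriction `H¹(K_∞^{(1)}, M) → H¹(K̃_∞, M)` (`K_∞^{(1)} = K̄^{ker κ₁}`) is ONTO the classes fixed by
`conj_{γ₂}` (`H²(ℤ_p, M^{Gal(K̄/K̃_∞)}) = 0`): cf2c-w8 g0's second-coordinate theorem for the swapped pair `(κ₂, κ₁; γ₂, γ₁)`, transported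
along `pairKer κ₁ κ₂ = pairKer κ₂ κ₁`. [cite: GreenbergLNM1716, §3 Lemma 3.2] [cite: SerreGaloisCohomology1997, I §3.4] -/
theorem mem_range_resOfLe_pairKer_left_of_conjH1_eq (hγ : IsTopGeneratorPair κ₁ κ₂ γ₁ γ₂)
    (hcont : ∀ m : M, Continuous fun g : Field.absoluteGaloisGroup K ↦ g • m) (hprim : ∀ m : M, ∃ k : ℕ, p ^ k • m = 0)
    (x : subgroupH1 (pairKer κ₁ κ₂) M) (hx : conjH1 (pairKer κ₁ κ₂) M γ₂ x = x) :
    x ∈ (resOfLe M (pairKer_le_left κ₁ κ₂)).range := by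
  have e₁ : pairKer κ₂ κ₁ ≤ pairKer κ₁ κ₂ := (pairKer_comm κ₂ κ₁).le
  have e₂ : pairKer κ₁ κ₂ ≤ pairKer κ₂ κ₁ := (pairKer_comm κ₁ κ₂).le
  -- transport `x` to the swapped pair; it is still fixed by `γ₂`
  have hx' : conjH1 (pairKer κ₂ κ₁) M γ₂ (resOfLe M e₁ x) = resOfLe M e₁ x := by
    rw [← Summit.BirchSwinnertonDyer.BirchSwinnertonDyer.Theorems.IwasawaTwoVariable.resOfLe_conjH1_comm e₁, hx]
  obtain ⟨y, hy⟩ := mem_range_resOfLe_pairKer_right_of_conjH1_eq hγ.symm hcont hprim (resOfLe M e₁ x) hx'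
  refine ⟨y, ?_⟩
  -- `res_{pairKer κ₁ κ₂ ≤ ker κ₁} y = res_{e₂} (res_{pairKer κ₂ κ₁ ≤ ker κ₁} y) = res_{e₂} (res_{e₁} x) = x`
  have h1 : resOfLe M (pairKer_le_left κ₁ κ₂) y = resOfLe M e₂ (resOfLe M (pairKer_le_right κ₂ κ₁) y) := by
    rw [resOfLe_resOfLe]
  rw [h1, hy, resOfLe_resOfLe, resOfLe_self]

/-- **Hence, with a `Γ_K`-stable subgroup in view: every `γ₂`-invariant class of `H¹(K̃_∞, M)` LIFTS to `H¹(K_∞^{(1)}, M)`** — the form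
the slot-1 control of M-LINE-PIN consumes ((C2a) `LinePinControl.mem_range_lineRes_unr_iff_exists_lift`: the lift decides membership in the
image by its behaviour at `𝔮 = v̄` alone). [cite: GreenbergLNM1716, §3 Lemma 3.2] -/
theorem exists_resOfLe_pairKer_left_eq_of_conjH1_eq (hγ : IsTopGeneratorPair κ₁ κ₂ γ₁ γ₂)
    (hcont : ∀ m : M, Continuous fun g : Field.absoluteGaloisGroup K ↦ g • m) (hprim : ∀ m : M, ∃ k : ℕ, p ^ k • m = 0)
    (x : subgroupH1 (pairKer κ₁ κ₂) M) (hx : conjH1 (pairKer κ₁ κ₂) M γ₂ x = x) :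
    ∃ y : subgroupH1 κ₁.kerSubgroup M, resOfLe M (pairKer_le_left κ₁ κ₂) y = x :=
  mem_range_resOfLe_pairKer_left_of_conjH1_eq hγ hcont hprim x hx

end Literature.NumberTheory.EllipticCurves.ZpExtension

end
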